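import Literature.Geometry.Kaehler.ComplexTorusCyclotomicAutomorphismOrderTwicePrimePower
import Literature.Geometry.Kaehler.ComplexTorusSimpleEndomorphismMinpoly
import Literature.NumberTheory.ComplexMultiplication.CMTorusIsogenousPowerOfSimple
import Mathlib.RingTheory.ZMod.UnitsCyclic
import Mathlib.NumberTheory.Cyclotomic.Gal
import HarnessLib

/-!
# No simple complex torus of dimension `2` has an automorphism of order `8` or `12`: the characteristic
# polynomials `Φ_8`, `Φ_12` lead to the biquadratic fields `ℚ(ζ_8)`, `ℚ(ζ_12)`, all of whose CM types are
# imprimitive — the orders of automorphisms of a simple `2`-torus are `1, 2, 3, 4, 5, 6, 10` (Fujiki 1988)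

Layer `Literature/Geometry/Kaehler`, namespace `Literature.Geometry.Kaehler.ComplexTorus`; lane `lit-hodgefound`
(Track 2 foundations library), Layer A2/A3 junction, row «A2-26(gg)» (self-proposed 2026-08-28, prover seat
`lit-hodgefound-p10`, generation 32, FILE 1 of the generation).  The crystallographic restriction (the tree's
`Literature.LinearAlgebra.Matrix.orderOf_mem_of_card_le_four`, Bamberg–Cairns–Kilminster) allows exactly the orders
`1, 2, 3, 4, 5, 6, 8, 10, 12` for an integer `4 × 4` matrix of finite order, and every one of them satisfies
`φ(n) ∣ 4`, so Swinnerton-Dyer's «`φ(n) ∣ 2g` for simple `X`» (the tree's `IsSimple.totient_dvd_card`) removes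
nothing in dimension `2`.  Complex multiplication does: for a SIMPLE `2`-dimensional complex torus `X` and `u ∈ End X`
of order `8` (resp. `12`) the rational characteristic polynomial is `Φ_8` (resp. `Φ_12`) — a power of the
irreducible minimal polynomial `Φ_n` of degree `φ(n) = 4 = rk` (`IsSimple.charpoly_eq_cyclotomic_pow`) —, so by
the structure theorem of generation 31 (FILE 1 `exists_cmType_ideal_iso_of_charpoly_eq_cyclotomic`, Shimura's
THEOREM 2) `(X, u) ≅ (ℂ^Φ/Φ(𝔞), ζ_n)` for a CM type `Φ` of `K = ℚ(ζ_8)` (resp. `ℚ(ζ_12)`).  But these two quartic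
fields are BIQUADRATIC — Galois over `ℚ` with group `(ℤ/8)ˣ ≅ (ℤ/12)ˣ ≅ (ℤ/2)²` — and Shimura §8.4 Example (2)(A)
(the tree's `not_isSimple_periodIso_of_not_isCyclic`, seat p01) says that NO CM type of a biquadratic quartic
field is primitive: the models `ℂ²/Φ(𝔞)` are never simple, indeed isogenous to the square of a CM elliptic
curve (the tree's `exists_isIsogenous_sq_of_not_isCyclic`, seat p11).  Simplicity is an isomorphism invariant —
contradiction.  Hence THE ORDER OF AN AUTOMORPHISM OF A SIMPLE COMPLEX TORUS OF DIMENSION `2` IS ONE OF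
`1, 2, 3, 4, 5, 6, 10`, and (generation 31, FILES 5 and 9: one abelian surface with an automorphism of order `5`,
the same one for order `10`) a simple `2`-torus with an automorphism of order `∉ {1, 2, 3, 4, 6}` IS the
`ζ_5`-surface `ℂ²/Φ₀(𝓞_{ℚ(ζ_5)})`.  This is the cyclic part of Fujiki's classification of the finite automorphism
groups of `2`-dimensional complex tori (Theorem 4.1 with Table 6: for `G ∋ −1` cyclic the pairs `(T, G)` are
products `E × E′` of elliptic curves except No. 6, `G ≅ ℨ_10`, «`T_5` is the simple abelian variety with period
matrix `(ζ ζ² ζ³ ζ⁴ …)`»; «in the cyclic case the possible orders of the groups are `2k` with `2 ≤ k ≤ 6`»).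

WHAT IS PROVED (theorems only; no `def`, no instance, no named fact; net debt 0).
* §1 THE FIELDS: `not_isCyclic_units_zmod_twelve` (`(ℤ/12)ˣ` is not cyclic; `(ℤ/8)ˣ` is Mathlib's
  `ZMod.not_isCyclic_units_eight`); for any `{8}`- (resp. `{12}`-) cyclotomic extension `K/ℚ`:
  `finrank_eq_four_of_isCyclotomicExtension_eight/twelve` (Galois: Mathlib's `IsCyclotomicExtension.isGalois`),
  **`not_isCyclic_algEquiv_of_isCyclotomicExtension_eight/twelve`** (`Gal(K/ℚ)` is not cyclic).
* §2 THE MODELS: **`not_isSimple_periodIso_eight/twelve`** (no `ℂ²/Φ(𝔞)`, `Φ` a CM type of `ℚ(ζ_8)` /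
  `ℚ(ζ_12)`, is simple), `exists_isIsogenous_sq_periodIso_eight/twelve` (each is isogenous to `E × E`, `E = ℂ/Φ₀(𝔞₀)`
  a CM elliptic curve of an imaginary quadratic subfield `K₀` inducing `Φ`).
* §3 THE PAIRS `(X, u)`, `P_u = Φ_8` / `Φ_12`: **`not_isSimple_of_charpoly_eq_cyclotomic_eight/twelve`**,
  `exists_isIsogenous_sq_of_charpoly_eq_cyclotomic_eight/twelve` (`X ∼ E × E`), and for ORDER `8` on a `2`-torus
  (`P_u = Φ_8` is forced, FILE 2): `not_isSimple_of_orderOf_eq_eight`, `exists_isIsogenous_sq_of_orderOf_eq_eight`.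
* §4 SIMPLE `2`-TORI: `IsSimple.charpoly_eq_cyclotomic_of_totient_orderOf_eq_card` (simple `X`, `u` of order `n`
  with `φ(n) = rk` ⟹ `P_u = Φ_n` over `ℤ`), **`IsSimple.orderOf_ne_eight`**, **`IsSimple.orderOf_ne_twelve`**,
  **`IsSimple.orderOf_mem_of_finrank_eq_two`** (`orderOf u ∈ {1, 2, 3, 4, 5, 6, 10}`).
* §5 **`isIsomorphic_periodIso_of_orderOf_eq_five_or_ten`**, **`IsSimple.orderOf_mem_or_isIsomorphic_periodIso`**:
  a simple `2`-torus with an endomorphism of finite order `n` has `n ∈ {1, 2, 3, 4, 6}` or is isomorphic to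
  `ℂ²/Φ₀(𝓞_{ℚ(ζ_5)})` (any CM type `Φ₀` of `ℚ(ζ_5)`).

Sources.  A. Fujiki, *Finite automorphism groups of complex tori of dimension two*, Publ. RIMS 24 (1988) 1–97,
held `paper:doi-10-2977-prims-1195175326` (read at source; OCR of the tables is poor, locators by page): §1 p. 5
L32–L33 «The groups which occur are either abelian with at most two generators, or dihedral of order 8 or 12; in
the cyclic case the possible orders of the groups are `2k` with `2 ≤ k ≤ 6`»; Lemma 3.2 p. 30 L38–L40 «Let `g` be
an automorphism of finite order `n` of a two dimensional complex torus `T`. Then `φ(n) ≤ 4`»; Lemma 2.5 p. 15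
L31 «Since `A` is generated by elements of finite order, `K` and `K_i` must be cyclotomic fields»; Theorem 4.1
p. 45 L5–L8 «Let `(T, G)` be a non-special pair with `−1 ∈ G`. Suppose that `G` is either abelian or dihedral.
Then `(T, G)` is isomorphic to one of the pairs in Tables 6, 7, and 8» with Table 6 (`G` cyclic, `−1 ∈ G`),
pp. 45–46, whose tori are products `E × E′`, `E_i × E_i`, `E_ρ × E_ρ` of elliptic curves except No. 6 (`𝔊 = ℨ_10`):
p. 45 L77 «In 6 `T_5` is the simple abelian variety with period matrix …».  G. Shimura, *Abelian Varieties with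
Complex Multiplication and Modular Functions* (1998), §8.4 Example (2)(A), p. 64 (no CM type of a biquadratic
quartic field is primitive; as formalised in the tree's `CMTorusSimpleQuartic.lean`); §6.1 Thm. 2 p. 41, §6.2
Thm. 3 p. 42.  J. Bamberg, G. Cairns, D. Kilminster, *The crystallographic restriction, permutations, and
Goldbach's conjecture*, Amer. Math. Monthly 110 (2003), Thm. 1.  Ch. Birkenhake, H. Lange, *Complex Abelian
Varieties*, 2nd ed. (2004), §13.3 — not held (acq-10211), locator as cited by this lane's earlier rows.

## References

* [Fujiki1988] A. Fujiki, *Finite automorphism groups of complex tori of dimension two*, Publ. Res. Inst. Math.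
  Sci. 24 (1988) 1–97, §1 p. 5, Lemma 2.5 p. 15, Lemma 3.2 p. 30, Theorem 4.1 and Table 6 pp. 45–46.
* [Shimura1998] G. Shimura, *Abelian Varieties with Complex Multiplication and Modular Functions*, Princeton
  Univ. Press (1998), §6.1 Thm. 2 p. 41, §6.2 Thm. 3 p. 42, §8.2 Prop. 26 p. 69, §8.4 Example (2)(A) p. 64.
* [BambergCairnsKilminster2003] J. Bamberg, G. Cairns, D. Kilminster, *The crystallographic restriction,
  permutations, and Goldbach's conjecture*, Amer. Math. Monthly 110 (2003) 202–209, Thm. 1.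
* [BirkenhakeLange2004] Ch. Birkenhake, H. Lange, *Complex Abelian Varieties*, 2nd ed., Grundlehren 302 (2004),
  §13.3.
-/

noncomputable section

open scoped Classical nonZeroDivisors NumberField Manifold ContDiff
open NumberField Module Polynomial

namespace Literature.Geometry.Kaehler

namespace ComplexTorus

open Literature.AlgebraicGeometry.Motives (CMType)
open Literature.NumberTheory.ComplexMultiplication (inducedCMType)
open Literature.NumberTheory.ComplexMultiplication.CMTypeLattice (periodIso
  not_isSimple_periodIso_of_not_isCyclic exists_isIsogenous_sq_of_not_isCyclic)
-- `CMTypeLattice.mulMatrix I a` (multiplication by `a ∈ 𝓞 K` on the ideal `I`) is spelled with its namespace below: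
-- the elliptic-curve files in the import cone declare a `ComplexTorus.mulMatrix` of their own.
open Literature.NumberTheory.ComplexMultiplication (CMTypeLattice.mulMatrix)

/-! ### §1 The biquadratic cyclotomic fields `ℚ(ζ_8)` and `ℚ(ζ_12)` -/

section Fields

/-- **`(ℤ/12)ˣ` is not cyclic**: every unit modulo `12` squares to `1`, so the exponent is `2 < 4 = |(ℤ/12)ˣ|`
(the companion of Mathlib's `ZMod.not_isCyclic_units_eight`). [cite: Fujiki1988, §1 p. 5 and Table 6 pp. 45–46 (the groups `ℨ_8`, `ℨ_12`)] [folklore] -/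
theorem not_isCyclic_units_zmod_twelve : ¬ IsCyclic (ZMod 12)ˣ := by
  intro h
  obtain ⟨g, hg⟩ := isCyclic_iff_exists_orderOf_eq_natCard.1 h
  have hcard : Nat.card (ZMod 12)ˣ = 4 := by
    rw [Nat.card_eq_fintype_card, ZMod.card_units_eq_totient]
    decide
  have h2 : ∀ u : (ZMod 12)ˣ, u ^ 2 = 1 := by decide
  have hdvd : orderOf g ∣ 2 := orderOf_dvd_of_pow_eq_one (h2 g)
  rw [hg, hcard] at hdvd
  omega

variable (K : Type) [Field K] [NumberField K]

section Eight

variable [IsCyclotomicExtension {8} ℚ K]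

/-- **`[ℚ(ζ_8) : ℚ] = φ(8) = 4`.** [cite: Shimura1998, §8.4 Example (2), p. 64] [folklore] -/
theorem finrank_eq_four_of_isCyclotomicExtension_eight : finrank ℚ K = 4 := by
  rw [IsCyclotomicExtension.Rat.finrank 8 K]
  decide

/-- **`Gal(ℚ(ζ_8)/ℚ) ≅ (ℤ/8)ˣ ≅ (ℤ/2)²` is not cyclic**: `ℚ(ζ_8) = ℚ(i, √2)` is biquadratic.
[cite: Shimura1998, §8.4 Example (2)(A), p. 64] [folklore] -/
theorem not_isCyclic_algEquiv_of_isCyclotomicExtension_eight : ¬ IsCyclic (K ≃ₐ[ℚ] K) := by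
  intro h
  haveI := h
  exact ZMod.not_isCyclic_units_eight
    (isCyclic_of_surjective (IsCyclotomicExtension.autEquivPow K (cyclotomic.irreducible_rat (by norm_num)))
      (MulEquiv.surjective _))

end Eight

section Twelve

variable [IsCyclotomicExtension {12} ℚ K]

/-- **`[ℚ(ζ_12) : ℚ] = φ(12) = 4`.** [cite: Shimura1998, §8.4 Example (2), p. 64] [folklore] -/
theorem finrank_eq_four_of_isCyclotomicExtension_twelve : finrank ℚ K = 4 := by
  rw [IsCyclotomicExtension.Rat.finrank 12 K]
  decide

/-- **`Gal(ℚ(ζ_12)/ℚ) ≅ (ℤ/12)ˣ ≅ (ℤ/2)²` is not cyclic**: `ℚ(ζ_12) = ℚ(i, √3)` is biquadratic.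
[cite: Shimura1998, §8.4 Example (2)(A), p. 64] [folklore] -/
theorem not_isCyclic_algEquiv_of_isCyclotomicExtension_twelve : ¬ IsCyclic (K ≃ₐ[ℚ] K) := by
  intro h
  haveI := h
  exact not_isCyclic_units_zmod_twelve
    (isCyclic_of_surjective (IsCyclotomicExtension.autEquivPow K (cyclotomic.irreducible_rat (by norm_num)))
      (MulEquiv.surjective _))

end Twelve

end Fields

/-! ### §2 The models `ℂ²/Φ(𝔞)` for `ℚ(ζ_8)`, `ℚ(ζ_12)` are never simple: they are isogenous to squares of CM elliptic curves -/

section Models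

variable {K : Type} [Field K] [NumberField K]

/-- **NO CM TORUS `ℂ²/Φ(𝔞)` OF `ℚ(ζ_8)` IS SIMPLE** (`Φ` any of the four CM types, `𝔞` any fractional ideal):
`ℚ(ζ_8)` is biquadratic, so no CM type is primitive (Shimura §8.4 (2)(A)). [cite: Shimura1998, §8.4 Example (2)(A) p. 64, §8.2 Prop. 26 p. 69]
[cite: Fujiki1988, Thm. 4.1 and Table 6, pp. 45–46] -/
theorem not_isSimple_periodIso_eight [IsCyclotomicExtension {8} ℚ K] (Φ : CMType K)
    (I : (FractionalIdeal (𝓞 K)⁰ K)ˣ) : ¬ ComplexTorus.IsSimple (periodIso Φ I) := by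
  haveI : IsGalois ℚ K := IsCyclotomicExtension.isGalois {8} ℚ K
  exact not_isSimple_periodIso_of_not_isCyclic (finrank_eq_four_of_isCyclotomicExtension_eight K)
    (not_isCyclic_algEquiv_of_isCyclotomicExtension_eight K) Φ I

/-- **`ℂ²/Φ(𝔞) ∼ E × E` for `ℚ(ζ_8)`**: the CM type `Φ` is induced from a CM type `Φ₀` of an imaginary quadratic
subfield `K₀ ⊂ ℚ(ζ_8)`, and `ℂ²/Φ(𝔞)` is isogenous to the square of the (simple) CM elliptic curve `ℂ/Φ₀(𝔞₀)` for
every fractional ideal `𝔞₀` of `K₀` (Shimura §6.2 Thm. 3 at torus level). [cite: Shimura1998, §6.2 Thm. 3 p. 42, §8.4 Example (2)(A) p. 64]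
[cite: Fujiki1988, Thm. 4.1 and Table 6, pp. 45–46] -/
theorem exists_isIsogenous_sq_periodIso_eight [IsCyclotomicExtension {8} ℚ K] (Φ : CMType K)
    (I : (FractionalIdeal (𝓞 K)⁰ K)ˣ) :
    ∃ (K₀ : IntermediateField ℚ K) (Φ₀ : CMType K₀),
      finrank ℚ K₀ = 2 ∧ inducedCMType (algebraMap K₀ K) Φ₀ = Φ ∧
      ∀ I₀ : (FractionalIdeal (𝓞 K₀)⁰ K₀)ˣ,
        ComplexTorus.IsSimple (periodIso Φ₀ I₀) ∧ IsIsogenous (periodIso Φ I) (powPeriod (periodIso Φ₀ I₀) 2) := by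
  haveI : IsGalois ℚ K := IsCyclotomicExtension.isGalois {8} ℚ K
  exact exists_isIsogenous_sq_of_not_isCyclic (finrank_eq_four_of_isCyclotomicExtension_eight K)
    (not_isCyclic_algEquiv_of_isCyclotomicExtension_eight K) Φ I

/-- **NO CM TORUS `ℂ²/Φ(𝔞)` OF `ℚ(ζ_12)` IS SIMPLE.** [cite: Shimura1998, §8.4 Example (2)(A) p. 64, §8.2 Prop. 26 p. 69]
[cite: Fujiki1988, Thm. 4.1 and Table 6, pp. 45–46] -/
theorem not_isSimple_periodIso_twelve [IsCyclotomicExtension {12} ℚ K] (Φ : CMType K)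
    (I : (FractionalIdeal (𝓞 K)⁰ K)ˣ) : ¬ ComplexTorus.IsSimple (periodIso Φ I) := by
  haveI : IsGalois ℚ K := IsCyclotomicExtension.isGalois {12} ℚ K
  exact not_isSimple_periodIso_of_not_isCyclic (finrank_eq_four_of_isCyclotomicExtension_twelve K)
    (not_isCyclic_algEquiv_of_isCyclotomicExtension_twelve K) Φ I

/-- **`ℂ²/Φ(𝔞) ∼ E × E` for `ℚ(ζ_12)`** (`E = ℂ/Φ₀(𝔞₀)` a CM elliptic curve of an imaginary quadratic subfield
`K₀ ⊂ ℚ(ζ_12)` whose type induces `Φ`). [cite: Shimura1998, §6.2 Thm. 3 p. 42, §8.4 Example (2)(A) p. 64]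
[cite: Fujiki1988, Thm. 4.1 and Table 6, pp. 45–46] -/
theorem exists_isIsogenous_sq_periodIso_twelve [IsCyclotomicExtension {12} ℚ K] (Φ : CMType K)
    (I : (FractionalIdeal (𝓞 K)⁰ K)ˣ) :
    ∃ (K₀ : IntermediateField ℚ K) (Φ₀ : CMType K₀),
      finrank ℚ K₀ = 2 ∧ inducedCMType (algebraMap K₀ K) Φ₀ = Φ ∧
      ∀ I₀ : (FractionalIdeal (𝓞 K₀)⁰ K₀)ˣ,
        ComplexTorus.IsSimple (periodIso Φ₀ I₀) ∧ IsIsogenous (periodIso Φ I) (powPeriod (periodIso Φ₀ I₀) 2) := by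
  haveI : IsGalois ℚ K := IsCyclotomicExtension.isGalois {12} ℚ K
  exact exists_isIsogenous_sq_of_not_isCyclic (finrank_eq_four_of_isCyclotomicExtension_twelve K)
    (not_isCyclic_algEquiv_of_isCyclotomicExtension_twelve K) Φ I

end Models

/-! ### §3 A complex torus with an endomorphism of characteristic polynomial `Φ_8` or `Φ_12` is not simple -/

section Pairs

variable {ι : Type} [Fintype ι] [DecidableEq ι] {E : Type} [NormedAddCommGroup E] [NormedSpace ℂ E]
  {P : (ι → ℝ) ≃L[ℝ] E}

set_option backward.isDefEq.respectTransparency false in -- Mathlib's instance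
-- `IsCyclotomicExtension {n} ℚ (CyclotomicField n ℚ)` is keyed on `CyclotomicField.algebra`, the goal on
-- `DivisionRing.toRatAlgebra` (same workaround as FILE 1 `isAbelianVariety_of_charpoly_eq_cyclotomic`)
/-- **A COMPLEX TORUS WITH `u ∈ End X`, `P_u = Φ_8`, IS NOT SIMPLE**: `(X, u) ≅ (ℂ^Φ/Φ(𝔞), ζ_8)` for a CM type
`Φ` of `ℚ(ζ_8)` (FILE 1) and the model is not simple (§2); simplicity is an isomorphism invariant.
[cite: Shimura1998, §6.1 Thm. 2 p. 41, §8.4 Example (2)(A) p. 64] [cite: Fujiki1988, Thm. 4.1 and Table 6, pp. 45–46] -/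
theorem not_isSimple_of_charpoly_eq_cyclotomic_eight {A : Matrix ι ι ℤ} (hA : A ∈ endRingInt P)
    (hP : A.charpoly = cyclotomic 8 ℤ) : ¬ ComplexTorus.IsSimple P := by
  intro hS
  have hζ := IsCyclotomicExtension.zeta_spec 8 ℚ (CyclotomicField 8 ℚ)
  obtain ⟨Φ, I, e, he, he₂, -⟩ := exists_cmType_ideal_iso_of_charpoly_eq_cyclotomic hζ hA hP
  exact not_isSimple_periodIso_eight Φ I ((IsIsomorphic.isSimple_iff ⟨e, he, he₂⟩).1 hS)

set_option backward.isDefEq.respectTransparency false in -- see `not_isSimple_of_charpoly_eq_cyclotomic_eight`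
/-- **`X ∼ E × E`**: a complex torus carrying `u ∈ End X` with `P_u = Φ_8` is isogenous to the square of a CM
elliptic curve `ℂ/Φ₀(𝔞₀)` — `Φ₀` a CM type of an imaginary quadratic subfield `K₀` of `ℚ(ζ_8)`, `𝔞₀` ANY fractional
ideal of `K₀`. [cite: Shimura1998, §6.1 Thm. 2 p. 41, §6.2 Thm. 3 p. 42, §8.4 Example (2)(A) p. 64]
[cite: Fujiki1988, Thm. 4.1 and Table 6, pp. 45–46] -/
theorem exists_isIsogenous_sq_of_charpoly_eq_cyclotomic_eight {A : Matrix ι ι ℤ} (hA : A ∈ endRingInt P)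
    (hP : A.charpoly = cyclotomic 8 ℤ) :
    ∃ (K₀ : IntermediateField ℚ (CyclotomicField 8 ℚ)) (Φ₀ : CMType K₀), finrank ℚ K₀ = 2 ∧
      ∀ I₀ : (FractionalIdeal (𝓞 K₀)⁰ K₀)ˣ,
        ComplexTorus.IsSimple (periodIso Φ₀ I₀) ∧ IsIsogenous P (powPeriod (periodIso Φ₀ I₀) 2) := by
  have hζ := IsCyclotomicExtension.zeta_spec 8 ℚ (CyclotomicField 8 ℚ)
  obtain ⟨Φ, I, e, he, he₂, -⟩ := exists_cmType_ideal_iso_of_charpoly_eq_cyclotomic hζ hA hP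
  obtain ⟨K₀, Φ₀, h2, -, hI⟩ := exists_isIsogenous_sq_periodIso_eight Φ I
  exact ⟨K₀, Φ₀, h2, fun I₀ ↦ ⟨(hI I₀).1,
    IsIsogenous.trans _ _ _ (IsIsomorphic.isIsogenous ⟨e, he, he₂⟩) (hI I₀).2⟩⟩

set_option backward.isDefEq.respectTransparency false in -- see `not_isSimple_of_charpoly_eq_cyclotomic_eight`
/-- **A COMPLEX TORUS WITH `u ∈ End X`, `P_u = Φ_12`, IS NOT SIMPLE.** [cite: Shimura1998, §6.1 Thm. 2 p. 41, §8.4 Example (2)(A) p. 64]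
[cite: Fujiki1988, Thm. 4.1 and Table 6, pp. 45–46] -/
theorem not_isSimple_of_charpoly_eq_cyclotomic_twelve {A : Matrix ι ι ℤ} (hA : A ∈ endRingInt P)
    (hP : A.charpoly = cyclotomic 12 ℤ) : ¬ ComplexTorus.IsSimple P := by
  intro hS
  have hζ := IsCyclotomicExtension.zeta_spec 12 ℚ (CyclotomicField 12 ℚ)
  obtain ⟨Φ, I, e, he, he₂, -⟩ := exists_cmType_ideal_iso_of_charpoly_eq_cyclotomic hζ hA hP
  exact not_isSimple_periodIso_twelve Φ I ((IsIsomorphic.isSimple_iff ⟨e, he, he₂⟩).1 hS)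

set_option backward.isDefEq.respectTransparency false in -- see `not_isSimple_of_charpoly_eq_cyclotomic_eight`
/-- **`X ∼ E × E`** for a complex torus carrying `u ∈ End X` with `P_u = Φ_12` (`E = ℂ/Φ₀(𝔞₀)` a CM elliptic curve
of an imaginary quadratic subfield of `ℚ(ζ_12)`). [cite: Shimura1998, §6.1 Thm. 2 p. 41, §6.2 Thm. 3 p. 42, §8.4 Example (2)(A) p. 64]
[cite: Fujiki1988, Thm. 4.1 and Table 6, pp. 45–46] -/
theorem exists_isIsogenous_sq_of_charpoly_eq_cyclotomic_twelve {A : Matrix ι ι ℤ} (hA : A ∈ endRingInt P)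
    (hP : A.charpoly = cyclotomic 12 ℤ) :
    ∃ (K₀ : IntermediateField ℚ (CyclotomicField 12 ℚ)) (Φ₀ : CMType K₀), finrank ℚ K₀ = 2 ∧
      ∀ I₀ : (FractionalIdeal (𝓞 K₀)⁰ K₀)ˣ,
        ComplexTorus.IsSimple (periodIso Φ₀ I₀) ∧ IsIsogenous P (powPeriod (periodIso Φ₀ I₀) 2) := by
  have hζ := IsCyclotomicExtension.zeta_spec 12 ℚ (CyclotomicField 12 ℚ)
  obtain ⟨Φ, I, e, he, he₂, -⟩ := exists_cmType_ideal_iso_of_charpoly_eq_cyclotomic hζ hA hP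
  obtain ⟨K₀, Φ₀, h2, -, hI⟩ := exists_isIsogenous_sq_periodIso_twelve Φ I
  exact ⟨K₀, Φ₀, h2, fun I₀ ↦ ⟨(hI I₀).1,
    IsIsogenous.trans _ _ _ (IsIsomorphic.isIsogenous ⟨e, he, he₂⟩) (hI I₀).2⟩⟩

/-- `8 = 2³` is a prime power. [folklore] -/
private theorem isPrimePow_eight : IsPrimePow 8 :=
  (isPrimePow_nat_iff 8).2 ⟨2, 3, Nat.prime_two, by norm_num, by norm_num⟩

/-- **A `2`-dimensional complex torus with an endomorphism of ORDER `8` is not simple** (order `8 = 2³` in rank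
`4 = φ(8)` forces `P_u = Φ_8`, FILE 2). [cite: Fujiki1988, Lemma 3.2 p. 30, Thm. 4.1 and Table 6 pp. 45–46]
[cite: Shimura1998, §8.4 Example (2)(A), p. 64] -/
theorem not_isSimple_of_orderOf_eq_eight {A : Matrix ι ι ℤ} (hA : A ∈ endRingInt P) (hord : orderOf A = 8)
    (hdim : finrank ℂ E = 2) : ¬ ComplexTorus.IsSimple P :=
  not_isSimple_of_charpoly_eq_cyclotomic_eight hA
    (charpoly_eq_cyclotomic_of_orderOf_eq_of_finrank P isPrimePow_eight hord (by rw [hdim]; decide))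

/-- … and it is isogenous to the square of a CM elliptic curve `ℂ/Φ₀(𝔞₀)`, `Φ₀` a CM type of an imaginary quadratic
subfield of `ℚ(ζ_8)`. [cite: Fujiki1988, Thm. 4.1 and Table 6, pp. 45–46] [cite: Shimura1998, §6.2 Thm. 3 p. 42, §8.4 Example (2)(A) p. 64] -/
theorem exists_isIsogenous_sq_of_orderOf_eq_eight {A : Matrix ι ι ℤ} (hA : A ∈ endRingInt P)
    (hord : orderOf A = 8) (hdim : finrank ℂ E = 2) :
    ∃ (K₀ : IntermediateField ℚ (CyclotomicField 8 ℚ)) (Φ₀ : CMType K₀), finrank ℚ K₀ = 2 ∧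
      ∀ I₀ : (FractionalIdeal (𝓞 K₀)⁰ K₀)ˣ,
        ComplexTorus.IsSimple (periodIso Φ₀ I₀) ∧ IsIsogenous P (powPeriod (periodIso Φ₀ I₀) 2) :=
  exists_isIsogenous_sq_of_charpoly_eq_cyclotomic_eight hA
    (charpoly_eq_cyclotomic_of_orderOf_eq_of_finrank P isPrimePow_eight hord (by rw [hdim]; decide))

end Pairs

/-! ### §4 Simple complex tori of dimension `2`: no automorphism of order `8`, none of order `12` -/

section Simple

variable {ι : Type} [Fintype ι] [DecidableEq ι] {E : Type} [NormedAddCommGroup E] [NormedSpace ℂ E]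
  {P : (ι → ℝ) ≃L[ℝ] E}

omit [DecidableEq ι] in
/-- `rk Λ = 2 dim_ℂ E` (finite-dimensionality read off the period isomorphism). [cite: Lange2023AbelianVarietiesComplex, §1.1.1] -/
private theorem card_eq_two_mul_finrank₃₂ (P : (ι → ℝ) ≃L[ℝ] E) : Fintype.card ι = 2 * finrank ℂ E := by
  have h1 : finrank ℝ (ι → ℝ) = finrank ℝ E := P.toLinearEquiv.finrank_eq
  rw [finrank_fintype_fun_eq_card, finrank_real_of_complex] at h1
  exact h1

omit [DecidableEq ι] in
/-- The order of an integer matrix equals the order of its image in `M_ι(ℚ)`. [folklore] -/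
private theorem orderOf_map_intCast₃₂ [DecidableEq ι] (A : Matrix ι ι ℤ) :
    orderOf (A.map (Int.cast : ℤ → ℚ)) = orderOf A := by
  have h := orderOf_injective ((Int.castRingHom ℚ).mapMatrix : Matrix ι ι ℤ →+* Matrix ι ι ℚ).toMonoidHom
    (fun M N hMN ↦ Matrix.map_injective (Int.cast_injective (α := ℚ))
      (by simpa [RingHom.mapMatrix_apply] using hMN)) A
  simpa [RingHom.mapMatrix_apply] using h

/-- **On a simple torus an endomorphism of finite order `n` with `φ(n) = rk Λ` has `P_u = Φ_n` (over `ℤ`)**: the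
rational characteristic polynomial is `Φ_n^{rk/φ(n)} = Φ_n` (Swinnerton-Dyer: a power of the irreducible minimal
polynomial, the tree's `IsSimple.charpoly_eq_cyclotomic_pow`). [cite: SwinnertonDyer1974AbelianVarieties, §8, proof of Lemma 42 (p. 65)]
[cite: Fujiki1988, Lemma 2.5 p. 15, Lemma 3.2 p. 30] -/
theorem IsSimple.charpoly_eq_cyclotomic_of_totient_orderOf_eq_card [Nonempty ι] (hX : ComplexTorus.IsSimple P)
    {A : Matrix ι ι ℤ} (hA : A ∈ endRingInt P) (hn : 0 < orderOf A)
    (hφ : Nat.totient (orderOf A) = Fintype.card ι) : A.charpoly = cyclotomic (orderOf A) ℤ := by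
  have hA' : A.map (Int.cast : ℤ → ℚ) ∈ endAlgRat P := (mem_endRingInt_iff P).1 hA
  have hn' : 0 < orderOf ((⟨A.map (Int.cast : ℤ → ℚ), hA'⟩ : endAlgRat P) : Matrix ι ι ℚ) := by
    rw [Subtype.coe_mk, orderOf_map_intCast₃₂]
    exact hn
  have h := hX.charpoly_eq_cyclotomic_pow ⟨A.map (Int.cast : ℤ → ℚ), hA'⟩ hn'
  rw [Subtype.coe_mk, orderOf_map_intCast₃₂, hφ, Nat.div_self Fintype.card_pos, pow_one] at h
  apply Polynomial.map_injective (Int.castRingHom ℚ) (Int.castRingHom ℚ).injective_int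
  rw [map_cyclotomic_int, ← Matrix.charpoly_map]
  exact h

/-- **NO SIMPLE COMPLEX TORUS OF DIMENSION `2` HAS AN ENDOMORPHISM OF ORDER `8`** (`P_u` would be `Φ_8`, and then
`X ≅ ℂ²/Φ(𝔞)` for the biquadratic `ℚ(ζ_8)` is not simple). [cite: Fujiki1988, Thm. 4.1 and Table 6, pp. 45–46]
[cite: Shimura1998, §8.4 Example (2)(A), p. 64] -/
theorem IsSimple.orderOf_ne_eight (hX : ComplexTorus.IsSimple P) {A : Matrix ι ι ℤ} (hA : A ∈ endRingInt P)
    (hdim : finrank ℂ E = 2) : orderOf A ≠ 8 := fun h8 ↦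
  not_isSimple_of_orderOf_eq_eight hA h8 hdim hX

/-- **NO SIMPLE COMPLEX TORUS OF DIMENSION `2` HAS AN ENDOMORPHISM OF ORDER `12`**: for simple `X` the rational
characteristic polynomial of `u` of order `12` is `Φ_12` (`φ(12) = 4 = rk`), so `X ≅ ℂ²/Φ(𝔞)` for the biquadratic
`ℚ(ζ_12)` — not simple. (Without simplicity `P_u = Φ_3 Φ_4` occurs: `E_i × E_ρ`.) [cite: Fujiki1988, Thm. 4.1 and Table 6, pp. 45–46]
[cite: Shimura1998, §8.4 Example (2)(A), p. 64] -/
theorem IsSimple.orderOf_ne_twelve (hX : ComplexTorus.IsSimple P) {A : Matrix ι ι ℤ} (hA : A ∈ endRingInt P)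
    (hdim : finrank ℂ E = 2) : orderOf A ≠ 12 := by
  intro h12
  have hcard : Fintype.card ι = 4 := by rw [card_eq_two_mul_finrank₃₂ P, hdim]
  haveI : Nonempty ι := Fintype.card_pos_iff.1 (by omega)
  have hP := hX.charpoly_eq_cyclotomic_of_totient_orderOf_eq_card hA (by omega) (by rw [h12, hcard]; decide)
  rw [h12] at hP
  exact not_isSimple_of_charpoly_eq_cyclotomic_twelve hA hP hX

/-- **THE ORDERS OF AUTOMORPHISMS OF A SIMPLE COMPLEX TORUS OF DIMENSION `2` ARE `1, 2, 3, 4, 5, 6, 10`**: the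
crystallographic list `{1, 2, 3, 4, 5, 6, 8, 10, 12}` of rank `4` (every member of which already has `φ(n) ∣ 4`)
minus `8` and `12`. [cite: Fujiki1988, §1 p. 5, Lemma 3.2 p. 30, Thm. 4.1 and Table 6 pp. 45–46]
[cite: BambergCairnsKilminster2003, Thm. 1] -/
theorem IsSimple.orderOf_mem_of_finrank_eq_two (hX : ComplexTorus.IsSimple P) {A : Matrix ι ι ℤ}
    (hA : A ∈ endRingInt P) (hn : 0 < orderOf A) (hdim : finrank ℂ E = 2) :
    orderOf A ∈ ({1, 2, 3, 4, 5, 6, 10} : Finset ℕ) := by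
  have hcard : Fintype.card ι = 4 := by rw [card_eq_two_mul_finrank₃₂ P, hdim]
  have hmem := Literature.LinearAlgebra.Matrix.orderOf_mem_of_card_le_four A hn hcard.le
  have h8 := hX.orderOf_ne_eight hA hdim
  have h12 := hX.orderOf_ne_twelve hA hdim
  simp only [Finset.mem_insert, Finset.mem_singleton] at hmem ⊢
  omega

end Simple

/-! ### §5 A simple `2`-torus with an automorphism of order `∉ {1, 2, 3, 4, 6}` is the `ζ_5`-surface -/

section Five

variable {ι : Type} [Fintype ι] [DecidableEq ι] {E : Type} [NormedAddCommGroup E] [NormedSpace ℂ E]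
  {P : (ι → ℝ) ≃L[ℝ] E} {K : Type} [Field K] [NumberField K] [IsCyclotomicExtension {5} ℚ K] {ζ : K}
  (hζ : IsPrimitiveRoot ζ 5)

include hζ in
/-- `dim_ℂ ℂ^{Φ₀} = 2` for a CM type `Φ₀` of `ℚ(ζ_5)` (`2 dim = φ(5) = 4`). [cite: Shimura1998, §6.2 Thm. 3 p. 42, §8.4 (2) p. 73] -/
private theorem finrank_pi_cmType_five (Φ₀ : CMType K) : finrank ℂ (Φ₀.1 → ℂ) = 2 := by
  have h := two_mul_finrank_pi_cmType (d := 5) (K := K) Φ₀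
  rw [Nat.totient_prime (by norm_num : Nat.Prime 5)] at h
  have := hζ
  omega

include hζ in
/-- **A `2`-dimensional complex torus with an endomorphism of order `5` or `10` is isomorphic to `ℂ²/Φ₀(𝓞_{ℚ(ζ_5)})`**
for EVERY CM type `Φ₀` of `ℚ(ζ_5)` (generation 31: one abelian surface with an automorphism of order `5`; the same
surface for order `10`). [cite: Fujiki1988, Thm. 4.1 and Table 6 No. 6, pp. 45–46 («`T_5` is the simple abelian variety»)]
[cite: Shimura1998, §7.4 Prop. 17 p. 58, §8.4 (2) p. 73] -/
theorem isIsomorphic_periodIso_of_orderOf_eq_five_or_ten (Φ₀ : CMType K) {A : Matrix ι ι ℤ}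
    (hA : A ∈ endRingInt P) (hord : orderOf A = 5 ∨ orderOf A = 10) (hdim : finrank ℂ E = 2) :
    IsIsomorphic P (periodIso Φ₀ 1) := by
  have hmem := mulMatrix_toInteger_mem_endRingInt hζ Φ₀ 1
  have h5 : orderOf (CMTypeLattice.mulMatrix 1 hζ.toInteger) = 5 := orderOf_mulMatrix_toInteger hζ Φ₀ 1
  have hdim' := finrank_pi_cmType_five hζ Φ₀
  rcases hord with h | h
  · obtain ⟨g, hg, hg', -⟩ := exists_iso_of_orderOf_eq_five hA h hdim hmem h5 hdim'
    exact ⟨g, hg, hg'⟩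
  · exact (isIsomorphic_of_orderOf_eq_five_ten hmem h5 hdim' hA h hdim).symm

include hζ in
/-- **DICHOTOMY FOR SIMPLE `2`-TORI**: an endomorphism of finite order of a simple `2`-dimensional complex torus `X`
has order `1, 2, 3, 4` or `6`, unless `X` is (isomorphic to) the `ζ_5`-surface `ℂ²/Φ₀(𝓞_{ℚ(ζ_5)})` — the cyclic
case of Fujiki's Table 6: apart from No. 6 (`ℨ_10` on `T_5`) every torus listed is a product of elliptic curves.
[cite: Fujiki1988, §1 p. 5, Thm. 4.1 and Table 6 pp. 45–46] [cite: Shimura1998, §8.4 Example (2)(A) p. 64, (2) p. 73] -/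
theorem IsSimple.orderOf_mem_or_isIsomorphic_periodIso (Φ₀ : CMType K) (hX : ComplexTorus.IsSimple P)
    {A : Matrix ι ι ℤ} (hA : A ∈ endRingInt P) (hn : 0 < orderOf A) (hdim : finrank ℂ E = 2) :
    orderOf A ∈ ({1, 2, 3, 4, 6} : Finset ℕ) ∨ IsIsomorphic P (periodIso Φ₀ 1) := by
  have hmem := hX.orderOf_mem_of_finrank_eq_two hA hn hdim
  by_cases h : orderOf A = 5 ∨ orderOf A = 10
  · exact Or.inr (ComplexTorus.isIsomorphic_periodIso_of_orderOf_eq_five_or_ten hζ Φ₀ hA h hdim)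
  · left
    simp only [Finset.mem_insert, Finset.mem_singleton] at hmem ⊢
    omega

end Five

end ComplexTorus

end Literature.Geometry.Kaehler

end
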